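import Summits.Ventures.HodgeRepro2.A2PontryaginLefschetz
import Summits.Ventures.HodgeRepro2.A2LiebermanModel

/-!
# The operator identity in the twelve-plane instance (A2 annex, operator identity — part 6)

The section's numbers: `ι = Fin 12` (`A2TwelvePlanes.ι₁₂`), `|ι| = 12`, `|P₀| = 4`.  Theorem A's
class `y = z ⋆ θ⁴` ((S3), (A4.3.3)) is `4!·(∏ c_p)·vol / 8! • Λ⁸ z` (`pontryagin_theta_pow_four`),
and for `z ∈ ⋀^{20}` it is `κ' • Λ⁸ L⁸ y''` with `y'' = (L⁸)⁻¹ z` the Lieberman class of (A9)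
(`pontryagin_eq_smul_lam_pow_lef_pow_yPP`): the two constructions of (A9) differ by the operator
`Λ⁸ L⁸`, which is the scalar `(8!)²` on primitive classes of degree `4` and whose Weil projection
is that scalar in general (row 104).
-/

namespace Summit.Ventures.HodgeRepro2.A2PontryaginLefschetzTwelve

open WeilPlanes WeilIntegral WeilCoproduct A2HardLefschetzOps A2HardLefschetzMain
  A2HardLefschetzTwelve A2LiebermanModel A2PontryaginModel A2PontryaginLefschetz A2TwelvePlanes

/-- `|ι₁₂| = 12`. -/
lemma card_ι₁₂ : Fintype.card ι₁₂ = 12 := Fintype.card_fin 12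

/-- **Theorem A's class in the twelve-plane model**: `z ⋆ θ⁴ = 4!·(∏ c_p)·vol / 8! • Λ⁸ z` for every
`z` and every `θ = Σ c_p E_p` with all `c_p ≠ 0`. -/
theorem pontryagin_theta_pow_four (c : ι₁₂ → ℂ) (hc : ∀ p, c p ≠ 0) (z : A ι₁₂) :
    pontryagin z (theta c ^ 4) =
      ((((4 : ℕ).factorial : ℂ) * ∏ p, c p) * vol ι₁₂ / ((8 : ℕ).factorial : ℂ)) •
        (lam c ^ 8) z := by
  have h4 : 4 ≤ Fintype.card ι₁₂ := by rw [card_ι₁₂]; norm_num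
  have h8 : Fintype.card ι₁₂ - 4 = 8 := by rw [card_ι₁₂]
  rw [pontryagin_theta_pow_eq_smul_lam_pow hc h4 z, kappa', h8]

/-- The constant of Theorem A's class is non-zero. -/
lemma four_constant_ne_zero (c : ι₁₂ → ℂ) (hc : ∀ p, c p ≠ 0) :
    (((4 : ℕ).factorial : ℂ) * ∏ p, c p) * vol ι₁₂ / ((8 : ℕ).factorial : ℂ) ≠ 0 := by
  have h8 : Fintype.card ι₁₂ - 4 = 8 := by rw [card_ι₁₂]
  have := kappa'_ne_zero hc (ι := ι₁₂) 4
  rwa [kappa', h8] at this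

/-- **The two constructions of (A9)**: for `z ∈ ⋀^{20}`, Theorem A's class `z ⋆ θ⁴` is
`κ' • Λ⁸ (θ⁸ ∧ y'')` with `y'' = (L⁸)⁻¹ z` the Lieberman class — the Pontryagin class is the
Lieberman class transported by the operator `Λ⁸ L⁸`. -/
theorem pontryagin_eq_smul_lam_pow_lef_pow_yPP (c : ι₁₂ → ℂ) (hc : ∀ p, c p ≠ 0) {z : A ι₁₂}
    (hz : z ∈ grading ι₁₂ 20) :
    pontryagin z (theta c ^ 4) =
      ((((4 : ℕ).factorial : ℂ) * ∏ p, c p) * vol ι₁₂ / ((8 : ℕ).factorial : ℂ)) •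
        (lam c ^ 8) (theta c ^ 8 * yPP c hc hz) := by
  have h4 : 4 ≤ Fintype.card ι₁₂ := by rw [card_ι₁₂]; norm_num
  have hz' : z ∈ grading ι₁₂ (2 * Fintype.card ι₁₂ - 4) := by rw [card_ι₁₂]; exact hz
  have h8 : Fintype.card ι₁₂ - 4 = 8 := by rw [card_ι₁₂]
  have key := theta_pow_mul_lefschetzInv c hc h4 hz'
  rw [h8] at key
  rw [pontryagin_theta_pow_four c hc z, yPP_eq_lefschetzInv c hc hz, key]

end Summit.Ventures.HodgeRepro2.A2PontryaginLefschetzTwelve
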